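import Literature.Topology.FourManifolds.HCobordismTradeStep
import HarnessLib

/-!
# Local alterations of a Morse function and its gradient-like field (Milnor 1965, Def. 3.1):
# what is unchanged near the critical points stays Morse / gradient-like

Topic `Literature/Topology/FourManifolds` (infrastructure for the fact seat
`provefact-Literature.Cobordism.Milnor1965_firstCancellation_slab`: in every step of Milnor's §§4–5 —
Thms. 4.1, 4.7, 5.4 — the Morse function `f` and the gradient-like field `ξ` of a triad are
altered away from the critical points (on `f⁻¹(a₀, a₁)`, *"on an arbitrarily small neighborhood
of `T`"*), and the text uses tacitly that the new pair is again a Morse function with a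
gradient-like field: Def. 3.1 asks for `ξ(f) > 0` off the critical points and for Milnor's
normal form *in some neighbourhood of each critical point*, both local conditions).  Everything
here is **proved**; no new notions.

* `Literature.Topology.FourManifolds.IsGradientLike.of_locallyEq` — if `(f, ξ)` is gradient-like (Def. 3.1,
  `Literature.Topology.FourManifolds.IsGradientLike`), `ξ'(f') > 0` at the non-critical points of `f'`, and near every critical
  point of `f'` one has `f' = f` and `ξ' = ξ`, then `(f', ξ')` is gradient-like (restrict Milnor's
  chart to the open set of agreement: Mathlib's `restr_mem_maximalAtlas`);
* `Literature.Topology.FourManifolds.IsMorse.of_eventuallyEq`, `Literature.Topology.FourManifolds.Cobordism.IsMorseFunction.of_eventuallyEq` — the same for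
  the Morse condition and for Morse functions on a cobordism (`Literature.Topology.FourManifolds.Cobordism.IsMorseFunction`),
  via the tree's `Literature.Topology.FourManifolds.mhessian_congr_of_eventuallyEq_add_const`;
* `Literature.Topology.FourManifolds.IsGradientLike.criticalSet_eq_setOf_mlineDeriv_le`, `Literature.Topology.FourManifolds.IsGradientLike.isClosed_criticalSet`
  — with a gradient-like field the critical set is `{ξ(f) ≤ 0}`, hence closed (compact on a
  compact `W`), so that non-critical levels have non-critical neighbouring levels
  (`Literature.Topology.FourManifolds.exists_pos_forall_le_abs_sub`, a compactness lemma);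
* `Literature.Topology.FourManifolds.Cobordism.IsMorseFunction.eq_zero_or_eq_one_of_mem_boundary`,
  `Literature.Topology.FourManifolds.Cobordism.IsMorseFunction.isInteriorPoint_of_mem_Ioo` — points of a cobordism with
  `0 < f < 1` are interior points (Def. 3.1: `f⁻¹(0) = V₀`, `f⁻¹(1) = V₁`).

## References

* J. Milnor, *Lectures on the h-cobordism theorem*, notes by L. Siebenmann and J. Sondow,
  Princeton Mathematical Notes (1965), Def. 3.1 (PDF pp. 11–12); Thm. 4.1 (PDF p. 22), Lemma 4.7
  (PDF p. 25), Thm. 5.4 (PDF p. 27). [MilnorHCobordism1965]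
-/

open scoped Manifold ContDiff Topology
open Set Function Filter

noncomputable section

namespace Literature.Topology.FourManifolds

universe u

/-- Local notation: `𝔼 n` is the model Euclidean space `EuclideanSpace ℝ (Fin n)`. -/
local notation "𝔼 " n:arg => EuclideanSpace ℝ (Fin n)

/-! ### A compactness lemma: a value not taken on a compact set is boundedly far -/

/-- If a continuous real function avoids the value `a` on a compact set `K`, it stays boundedly
away from `a` on `K`. [folklore] -/
theorem exists_pos_forall_le_abs_sub {X : Type*} [TopologicalSpace X] {K : Set X} (hK : IsCompact K)
    {g : X → ℝ} (hg : Continuous g) {a : ℝ} (ha : ∀ z ∈ K, g z ≠ a) :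
    ∃ δ > 0, ∀ z ∈ K, δ ≤ |g z - a| := by
  rcases K.eq_empty_or_nonempty with rfl | hne
  · exact ⟨1, one_pos, fun z hz => hz.elim⟩
  · obtain ⟨z₀, hz₀, hmin⟩ :=
      hK.exists_isMinOn hne (continuous_abs.comp (hg.sub continuous_const)).continuousOn
    exact ⟨|g z₀ - a|, abs_pos.2 (sub_ne_zero.2 (ha z₀ hz₀)), fun z hz => hmin hz⟩

/-! ### The Morse condition under local alterations -/

section Morse

variable {E H : Type*} [NormedAddCommGroup E] [NormedSpace ℝ E] [TopologicalSpace H]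
  {I : ModelWithCorners ℝ E H} {M : Type*} [TopologicalSpace M] [ChartedSpace H M]

/-- **A smooth function which agrees with a Morse function near each of its own critical points is
Morse** (the Hessian at a critical point only sees the germ). [cite: MilnorHCobordism1965, Def. 3.1 and Thm. 4.1 (PDF pp. 11, 22)] -/
theorem IsMorse.of_eventuallyEq {f f' : M → ℝ} (hf : IsMorse I f) (hf' : ContMDiff I 𝓘(ℝ, ℝ) ∞ f')
    (hloc : ∀ p, IsMCriticalPt I f' p → f' =ᶠ[𝓝 p] f) : IsMorse I f' := by
  refine ⟨hf', fun p hp => ?_⟩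
  have hev : f' =ᶠ[𝓝 p] fun y => f y + 0 := (hloc p hp).trans (by simp)
  rw [mhessian_congr_of_eventuallyEq_add_const hev]
  exact hf.2 p ((isMCriticalPt_congr_of_eventuallyEq (hloc p hp)).1 hp)

end Morse

/-! ### Morse functions on a cobordism -/

namespace Cobordism

variable {n : ℕ} {M N : Type u} [TopologicalSpace M] [ChartedSpace (𝔼 n) M]
  [TopologicalSpace N] [ChartedSpace (𝔼 n) N]

/-- On the boundary a Morse function of the cobordism is `0` (on `V₀ = inl M`) or `1` (on
`V₁ = inr N`). [cite: MilnorHCobordism1965, Def. 3.1 (PDF p. 11)] -/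
theorem IsMorseFunction.eq_zero_or_eq_one_of_mem_boundary {c : Cobordism n M N} {f : c.W → ℝ}
    (hf : c.IsMorseFunction f) {z : c.W} (hz : z ∈ (𝓡∂ (n + 1)).boundary c.W) :
    f z = 0 ∨ f z = 1 := by
  rw [← c.range_inl_union_range_inr] at hz
  rcases hz with ⟨x, rfl⟩ | ⟨y, rfl⟩
  · exact Or.inl (hf.2.1 x)
  · exact Or.inr (hf.2.2.1 y)

/-- **Points with `0 < f < 1` are interior points of the cobordism** (`f⁻¹(0) = V₀`,
`f⁻¹(1) = V₁`). [cite: MilnorHCobordism1965, Def. 3.1 (PDF p. 11)] -/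
theorem IsMorseFunction.isInteriorPoint_of_mem_Ioo {c : Cobordism n M N} {f : c.W → ℝ}
    (hf : c.IsMorseFunction f) {z : c.W} (hz : f z ∈ Ioo (0 : ℝ) 1) :
    (𝓡∂ (n + 1)).IsInteriorPoint z := by
  by_contra h
  have hb : z ∈ (𝓡∂ (n + 1)).boundary c.W :=
    ((𝓡∂ (n + 1)).isInteriorPoint_iff_not_isBoundaryPoint z).not_left.1 h
  rcases hf.eq_zero_or_eq_one_of_mem_boundary hb with h0 | h1
  · exact absurd h0 (ne_of_gt hz.1)
  · exact absurd h1 (ne_of_lt hz.2)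

/-- **A local alteration of a Morse function on a cobordism is a Morse function on it**: if `f'`
is smooth, agrees with the Morse function `f` of `c` near the boundary and near each of its own
critical points, and takes values in `(0, 1)` on the interior, then `f'` is a Morse function on
`c` (Milnor's alterations of 4.1, 4.7, 5.4 all *"agree with `f` near `V₀ ∪ V₁`"*). [cite: MilnorHCobordism1965, Def. 3.1, Thms. 4.1, 5.4 (PDF pp. 11, 22, 27)] -/
theorem IsMorseFunction.of_eventuallyEq {c : Cobordism n M N} {f f' : c.W → ℝ}
    (hf : c.IsMorseFunction f) (hf' : ContMDiff (𝓡∂ (n + 1)) 𝓘(ℝ, ℝ) ∞ f')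
    (hcrit : ∀ p, IsMCriticalPt (𝓡∂ (n + 1)) f' p → f' =ᶠ[𝓝 p] f)
    (hbd : ∀ p ∈ (𝓡∂ (n + 1)).boundary c.W, f' =ᶠ[𝓝 p] f)
    (hint : ∀ z ∈ (𝓡∂ (n + 1)).interior c.W, f' z ∈ Ioo (0 : ℝ) 1) : c.IsMorseFunction f' := by
  refine ⟨hf.isMorse.of_eventuallyEq hf' hcrit, fun x => ?_, fun y => ?_, fun z hz hcz => ?_, hint⟩
  · rw [(hbd _ (c.inl_mem_boundary x)).self_of_nhds]; exact hf.2.1 x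
  · rw [(hbd _ (c.inr_mem_boundary y)).self_of_nhds]; exact hf.2.2.1 y
  · exact hf.2.2.2.1 z hz ((isMCriticalPt_congr_of_eventuallyEq (hbd z hz)).1 hcz)

end Cobordism

/-! ### Gradient-like fields under local alterations; the critical set is `{ξ(f) ≤ 0}` -/

section GradientLike

variable {m : ℕ} {H : Type*} [TopologicalSpace H] {J : ModelWithCorners ℝ (𝔼 m) H}
  {M : Type*} [TopologicalSpace M] [ChartedSpace H M]
  {f : M → ℝ} {ξ : Π x : M, TangentSpace J x}

/-- With a gradient-like field `ξ`, the critical set of `f` is `{ξ(f) ≤ 0}` (`ξ(f) > 0` off the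
critical set, `ξ(f) = df(ξ) = 0` on it). [cite: MilnorHCobordism1965, Def. 3.1 (PDF pp. 11–12)] -/
theorem IsGradientLike.criticalSet_eq_setOf_mlineDeriv_le (h : IsGradientLike J f ξ) :
    criticalSet J f = {z | mlineDeriv J f z (ξ z) ≤ 0} := by
  ext z
  simp only [mem_criticalSet, mem_setOf_eq]
  constructor
  · intro hz
    have : mlineDeriv J f z (ξ z) = 0 := by
      change mfderiv J 𝓘(ℝ, ℝ) f z (ξ z) = 0
      rw [show mfderiv J 𝓘(ℝ, ℝ) f z = 0 from hz]
      rfl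
    exact this.le
  · intro hz
    by_contra hnc
    exact absurd (h.mlineDeriv_pos z hnc) (not_lt.2 hz)

/-- **The critical set of a function with a gradient-like field is closed** as soon as `ξ(f)` is
continuous (e.g. `f` and `ξ` smooth, `Literature.Topology.FourManifolds.contMDiff_mlineDeriv_section`). [cite: MilnorHCobordism1965, Def. 3.1 (PDF pp. 11–12)] -/
theorem IsGradientLike.isClosed_criticalSet (h : IsGradientLike J f ξ)
    (hc : Continuous fun z => mlineDeriv J f z (ξ z)) : IsClosed (criticalSet J f) := by
  rw [h.criticalSet_eq_setOf_mlineDeriv_le]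
  exact isClosed_le hc continuous_const

/-- **Milnor 1965, Def. 3.1 is local: a pair `(f', ξ')` which has `ξ'(f') > 0` at the
non-critical points of `f'` and agrees with a gradient-like pair `(f, ξ)` near every critical
point of `f'` is gradient-like.**  (Milnor's coordinate neighbourhood `U` of 3.1 2) for `(f, ξ)`
at such a point, cut down to the open set where the pairs agree, is one for `(f', ξ')`: charts of
the maximal atlas restrict to open subsets, Mathlib's `restr_mem_maximalAtlas`.)  This is what
makes the alterations of Thms. 4.1, 4.7 and 5.4, supported away from the critical points, again
gradient-like pairs. [cite: MilnorHCobordism1965, Def. 3.1 (PDF pp. 11–12); Lemma 4.7 (PDF p. 25)] -/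
theorem IsGradientLike.of_locallyEq (h : IsGradientLike J f ξ) {f' : M → ℝ}
    {ξ' : Π x : M, TangentSpace J x}
    (hpos : ∀ p, ¬ IsMCriticalPt J f' p → 0 < mlineDeriv J f' p (ξ' p))
    (hloc : ∀ p, IsMCriticalPt J f' p →
      ∃ U : Set M, IsOpen U ∧ p ∈ U ∧ EqOn f' f U ∧ ∀ q ∈ U, ξ' q = ξ q) :
    IsGradientLike J f' ξ' where
  mlineDeriv_pos := hpos
  exists_chart p hp := by
    obtain ⟨U, hUo, hpU, hfU, hξU⟩ := hloc p hp
    have hev : f' =ᶠ[𝓝 p] f := eventuallyEq_of_mem (hUo.mem_nhds hpU) hfU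
    have hp' : IsMCriticalPt J f p := (isMCriticalPt_congr_of_eventuallyEq hev).1 hp
    obtain ⟨φ, hφ, k, hpφ, hfφ, hξφ⟩ := h.exists_chart p hp'
    have hsrc : (φ.restr U).source = φ.source ∩ U := φ.restr_source' U hUo
    have hcoe : ((φ.restr U).extend J : M → 𝔼 m) = φ.extend J := by
      funext x
      simp only [OpenPartialHomeomorph.extend_coe, Function.comp_apply,
        OpenPartialHomeomorph.restr_apply]
    refine ⟨φ.restr U, restr_mem_maximalAtlas (contDiffGroupoid ∞ J) hφ hUo, k, ?_, ?_, ?_⟩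
    · rw [hsrc]; exact ⟨hpφ, hpU⟩
    · intro q hq
      rw [hsrc] at hq
      rw [hcoe, hfU hq.2, hfU hpU]
      exact hfφ q hq.1
    · intro q hq
      rw [hsrc] at hq
      rw [hcoe, hξU q hq.2]
      exact hξφ q hq.1

end GradientLike

end Literature.Topology.FourManifolds
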